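import Literature.NumberTheory.Sieve.ShiuBrunTitchmarsh
import Literature.NumberTheory.Sieve.DivisorPowerSums
import Literature.NumberTheory.Sieve.LandreauInequality
import HarnessLib

/-!
# Bombieri–Friedlander–Iwaniec 1986, Lemma 3 — proof

Topic `Literature/NumberTheory/Sieve`.  Discharge of the named fact
`Literature.NumberTheory.Sieve.BombieriFriedlanderIwaniecLemma3` (E. Bombieri, J. B. Friedlander,
H. Iwaniec, *Primes in arithmetic progressions to large moduli*, Acta Math. 156 (1986), §2 Lemma 3,
p. 211): for `a ≠ 0`, `A > 0`, `ε > 0` there are `B, C, x₀` with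
`∑_{|a| < m ≤ x, m ≡ l (k)} τ(m)^A τ(m − a)^A ≤ C (x/k) (τ(k) log x)^B` for `x ≥ x₀`,
`1 ≤ k ≤ x^{1−ε}` and every class `l (mod k)`.

## The proof given here

The printed proof is "Apply Cauchy's inequality and Theorem 2 of [19]" ([19] = Shiu 1980).  We
replace Cauchy by `uv ≤ u² + v²` (so the sum is at most `∑ τ(m)^{2A} + ∑ τ(m−a)^{2A}`, two sums of
`τ^s`, `s = ⌈2A⌉`, over arithmetic progressions mod `k` of length `≪ x`), and Shiu's theorem by the
following ELEMENTARY Brun–Titchmarsh-type bound, sufficient because the exponent `B` is unspecified: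
for `X ≥ 2`, `k X^δ ≤ X` and any residue class `r (mod k)` (coprime to `k` or not),
`∑_{n ≤ X, n ≡ r (k)} τ(n)^s ≤ C (X/k) τ(k)^{B₁} (log X)^{B₂}` (`sum_AP_sigma_pow_le`).  Its proof:
Landreau's inequality in maximal form (`exists_dvd_card_divisors_le`, the pigeonhole step of
Tao–Teräväinen's Lemma 3.1 (ii), from the tree's `Landreau.exists_factorization`) gives
`τ(n)^s ≤ C ∑_{d ∣ n, d ≤ X^δ} τ(d)^q`; the `n ≤ X` in the class `r (mod k)` divisible by `d` lie in
one class modulo `lcm(d,k) ≤ X`, so there are `≤ 2X (d,k)/(dk)` of them (`card_filter_dvd_le`);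
and `∑_{d ≤ Z} τ(d)^q (d,k)/d ≤ τ(k)^{q+1} ∑_{m ≤ Z} τ(m)^q/m ≪ τ(k)^{q+1} (log X)^{2^{q+1}}`
(`sum_sigma_pow_mul_gcd_div_le` and the tree's `exists_sum_sigma_zero_pow_div_le`).
No new named facts are introduced; Shiu's theorem (`Shiu1980BrunTitchmarsh`) is NOT used.

## References

* E. Bombieri, J. B. Friedlander, H. Iwaniec, Acta Math. 156 (1986), 203–251, §2 Lemma 3.
  [BombieriFriedlanderIwaniecActa1986]
* T. Tao, J. Teräväinen, *The Hardy–Littlewood–Chowla conjecture in the presence of a Siegel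
  zero*, Lemma 3.1 (Landreau's inequality). [TaoTeravainen2021] [Landreau1989]
-/

open Finset Real
open scoped ArithmeticFunction.sigma ArithmeticFunction.Omega

namespace Literature.NumberTheory.Sieve

namespace BFILemma3

/-! ### Landreau's inequality, maximal form -/

/-- `τ(m) ≤ 2^{Ω(m)}` for `m ≠ 0` (`e + 1 ≤ 2^e` at each prime power). [folklore] -/
private theorem card_divisors_le_two_pow_cardFactors {m : ℕ} (hm : m ≠ 0) :
    m.divisors.card ≤ 2 ^ Ω m := by
  rw [Nat.card_divisors hm, ArithmeticFunction.cardFactors_apply,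
    ← List.sum_toFinset_count_eq_length, ← Finset.prod_pow_eq_pow_sum]
  have hset : m.primeFactorsList.toFinset = m.primeFactors := rfl
  rw [hset]
  refine Finset.prod_le_prod' fun p _ => ?_
  rw [Nat.primeFactorsList_count_eq]
  exact Nat.succ_le_of_lt Nat.lt_two_pow_self

/-- **Landreau's inequality, maximal form** (the pigeonhole step of the proof of Tao–Teräväinen,
Lemma 3.1 (ii)): for `ε > 0` there are `C > 0` and `M` such that every `n ≥ 1` has, for every
`y ≥ n^ε`, a divisor `d ≤ y` with `τ(n) ≤ C τ(d)^M` (`C = 2^{2/ε}`, `M = ⌊1 + 2/ε⌋`).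
[cite: TaoTeravainen2021, Lemma 3.1 (ii) and its proof] -/
theorem exists_dvd_card_divisors_le {ε : ℝ} (hε : 0 < ε) :
    ∃ C : ℝ, 0 < C ∧ ∃ M : ℕ, ∀ n : ℕ, n ≠ 0 → ∀ y : ℝ, (n : ℝ) ^ ε ≤ y →
      ∃ d : ℕ, d ∣ n ∧ (d : ℝ) ≤ y ∧ (n.divisors.card : ℝ) ≤ C * (d.divisors.card : ℝ) ^ M := by
  refine ⟨(2 : ℝ) ^ (2 / ε), by positivity, ⌊1 + 2 / ε⌋₊, fun n hn y hy => ?_⟩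
  set C : ℝ := (2 : ℝ) ^ (2 / ε) with hC
  set M : ℕ := ⌊1 + 2 / ε⌋₊ with hM
  have hC1 : 1 ≤ C := Real.one_le_rpow one_le_two (by positivity)
  have hn0 : (0 : ℝ) < n := by exact_mod_cast Nat.pos_of_ne_zero hn
  have hy1 : (1 : ℝ) ≤ y :=
    (Real.one_le_rpow (by exact_mod_cast Nat.pos_of_ne_zero hn) hε.le).trans hy
  rcases Nat.lt_or_ge 1 n with h1n | hn1
  · have hn1 : (1 : ℝ) < n := by exact_mod_cast h1n
    have hlogn : 0 < Real.log n := Real.log_pos hn1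
    set z : ℝ := (n : ℝ) ^ (ε / 2) with hz
    set y₀ : ℝ := (n : ℝ) ^ ε with hy₀
    have hz1 : 1 < z := Real.one_lt_rpow hn1 (by positivity)
    have hzy : z < y₀ := Real.rpow_lt_rpow_of_exponent_lt hn1 (by linarith)
    have hlogz : Real.log z = ε / 2 * Real.log n := Real.log_rpow hn0 _
    have hyz : y₀ / z = z := by
      rw [hy₀, hz, ← Real.rpow_sub hn0]
      congr 1
      ring
    obtain ⟨l, hlprod, hlmem, hllen⟩ := Landreau.exists_factorization hz1 hzy hn
    set k := ⌊z⌋₊ + 1 with hk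
    -- `τ(n) = τ(n_(≤z)) τ(n_(>z))`
    have hsplit : n.divisors.card =
        (smoothPart k n).divisors.card * (n / smoothPart k n).divisors.card := by
      conv_lhs => rw [← smoothPart_mul_div hn k]
      exact Nat.Coprime.card_divisors_mul (coprime_smoothPart_div hn)
    -- `τ(n_(>z)) ≤ 2^{Ω} ≤ 2^{2/ε} = C`
    have hrough : ((n / smoothPart k n).divisors.card : ℝ) ≤ C := by
      have h1 : ((n / smoothPart k n).divisors.card : ℝ) ≤
          (2 : ℝ) ^ (Ω (n / smoothPart k n) : ℝ) := by
        rw [Real.rpow_natCast]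
        exact_mod_cast card_divisors_le_two_pow_cardFactors (m := n / smoothPart k n)
          fun h0 => hn (by rw [← smoothPart_mul_div hn k, h0, mul_zero])
      have h2 : (Ω (n / smoothPart k n) : ℝ) ≤ 2 / ε := by
        have := Landreau.cardFactors_div_smoothPart_le hz1 hn
        rw [hlogz] at this
        calc (Ω (n / smoothPart (⌊z⌋₊ + 1) n) : ℝ) ≤ Real.log n / (ε / 2 * Real.log n) := this
          _ = 2 / ε := by field_simp
      exact h1.trans (Real.rpow_le_rpow_of_exponent_le one_le_two h2)
    -- the number of factors is `≤ M`
    have hmM : l.length ≤ M := by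
      rw [hM]
      refine Nat.le_floor ?_
      have : Real.log n / Real.log (y₀ / z) = 2 / ε := by
        rw [hyz, hlogz]
        field_simp
      rw [this] at hllen
      exact_mod_cast hllen
    -- `τ(n_(≤z)) ≤ τ(d)^M` for a suitable admissible `d`
    have key : ∃ d : ℕ, d ∣ n ∧ (d : ℝ) ≤ y ∧
        (smoothPart k n).divisors.card ≤ d.divisors.card ^ M := by
      rcases l with _ | ⟨a, l'⟩
      · refine ⟨1, one_dvd n, by exact_mod_cast hy1, ?_⟩
        rw [List.prod_nil] at hlprod
        rw [← hlprod]
        simp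
      · classical
        set L := a :: l' with hL
        have hLne : L.toFinset.Nonempty := ⟨a, by simp [hL]⟩
        obtain ⟨b, hbL, hbmax⟩ :=
          Finset.exists_max_image L.toFinset (fun c => c.divisors.card) hLne
        rw [List.mem_toFinset] at hbL
        obtain ⟨hb1, hby, hbn, -⟩ := hlmem b hbL
        have hB : ∀ c ∈ L, c.divisors.card ≤ b.divisors.card := fun c hc =>
          hbmax c (List.mem_toFinset.mpr hc)
        have hτb : 0 < b.divisors.card :=
          Finset.card_pos.mpr ⟨1, Nat.one_mem_divisors.mpr (by omega)⟩
        refine ⟨b, hbn, hby.trans hy, ?_⟩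
        rw [← hlprod]
        exact (Landreau.card_divisors_prod_le_pow L hB).trans (Nat.pow_le_pow_right hτb hmM)
    obtain ⟨d, hdn, hdy, hsm⟩ := key
    refine ⟨d, hdn, hdy, ?_⟩
    calc (n.divisors.card : ℝ)
        = ((smoothPart k n).divisors.card : ℝ) * ((n / smoothPart k n).divisors.card : ℝ) := by
          rw [hsplit, Nat.cast_mul]
      _ ≤ ((d.divisors.card : ℝ) ^ M) * C :=
          mul_le_mul (by exact_mod_cast hsm) hrough (by positivity) (by positivity)
      _ = C * (d.divisors.card : ℝ) ^ M := mul_comm _ _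
  · have hn1' : n = 1 := by omega
    subst hn1'
    refine ⟨1, one_dvd 1, by exact_mod_cast hy1, ?_⟩
    simp only [Nat.divisors_one, Finset.card_singleton, Nat.cast_one, one_pow, mul_one]
    exact hC1

/-! ### Counting multiples of `d` in a residue class -/

/-- The `n ≤ X` divisible by `d` in a fixed residue class modulo `k` lie in a single residue class
modulo `lcm(d, k)`, so there are at most `X / lcm(d, k) + 1` of them. [folklore] -/
theorem card_filter_dvd_le (X : ℕ) {d k : ℕ} (hd : 0 < d) (hk : 0 < k) (r : ZMod k) :
    ((Icc 1 X).filter (fun n : ℕ => (n : ZMod k) = r ∧ d ∣ n)).card ≤ X / Nat.lcm d k + 1 := by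
  set L := Nat.lcm d k with hL
  have hL0 : 0 < L := Nat.lcm_pos hd hk
  set S := (Icc 1 X).filter (fun n : ℕ => (n : ZMod k) = r ∧ d ∣ n) with hS
  have hmod : ∀ n ∈ S, ∀ n' ∈ S, n % L = n' % L := by
    intro n hn n' hn'
    rw [hS, Finset.mem_filter] at hn hn'
    have h1 : n ≡ n' [MOD d] :=
      (Nat.modEq_zero_iff_dvd.2 hn.2.2).trans (Nat.modEq_zero_iff_dvd.2 hn'.2.2).symm
    have h2 : n ≡ n' [MOD k] :=
      (ZMod.natCast_eq_natCast_iff _ _ _).1 (hn.2.1.trans hn'.2.1.symm)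
    exact Nat.mod_lcm h1 h2
  calc S.card ≤ (Finset.range (X / L + 1)).card := by
        refine Finset.card_le_card_of_injOn (fun n => n / L) (fun n hn => ?_)
          (fun n hn n' hn' h => ?_)
        · have hn' := (Finset.mem_filter.1 (Finset.mem_coe.1 hn)).1
          exact Finset.mem_coe.2 (Finset.mem_range.2
            (Nat.lt_succ_of_le (Nat.div_le_div_right (Finset.mem_Icc.1 hn').2)))
        · have h' : n / L = n' / L := h
          have hm := hmod n (Finset.mem_coe.1 hn) n' (Finset.mem_coe.1 hn')
          calc n = L * (n / L) + n % L := (Nat.div_add_mod n L).symm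
            _ = L * (n' / L) + n' % L := by rw [h', hm]
            _ = n' := Nat.div_add_mod n' L
    _ = X / L + 1 := Finset.card_range _

/-! ### The `gcd`-weighted divisor sum -/

/-- `∑_{d ≤ Z} τ(d)^q (d,k)/d ≤ τ(k)^{q+1} ∑_{m ≤ Z} τ(m)^q/m` for `k ≠ 0` (write `d = g m` with
`g = (d,k) ∣ k`; `τ(d) ≤ τ(g) τ(m) ≤ τ(k) τ(m)`; at most `τ(k)` values of `g`). [folklore] -/
theorem sum_sigma_pow_mul_gcd_div_le {k : ℕ} (hk : k ≠ 0) (q Z : ℕ) :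
    ∑ d ∈ Icc 1 Z, (σ 0 d : ℝ) ^ q * (Nat.gcd d k : ℝ) / d ≤
      (σ 0 k : ℝ) ^ (q + 1) * ∑ m ∈ Icc 1 Z, (σ 0 m : ℝ) ^ q / m := by
  classical
  set φ : ℕ → ℕ × ℕ := fun d => (Nat.gcd d k, d / Nat.gcd d k) with hφ
  set G : ℕ × ℕ → ℝ := fun y => (σ 0 y.1 : ℝ) ^ q * ((σ 0 y.2 : ℝ) ^ q / y.2) with hG
  have hG0 : ∀ y, 0 ≤ G y := fun y => by positivity
  have hdecomp : ∀ d : ℕ, Nat.gcd d k * (d / Nat.gcd d k) = d := fun d =>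
    Nat.mul_div_cancel' (Nat.gcd_dvd_left d k)
  -- termwise comparison
  have hterm : ∀ d ∈ Icc 1 Z, (σ 0 d : ℝ) ^ q * (Nat.gcd d k : ℝ) / d ≤ G (φ d) := by
    intro d hd
    rw [mem_Icc] at hd
    set g := Nat.gcd d k with hg
    set m := d / g with hm
    have hg0 : 0 < g := Nat.gcd_pos_of_pos_left k hd.1
    have hgm : g * m = d := hdecomp d
    have hm0 : 0 < m := Nat.pos_of_ne_zero fun h => by rw [h, mul_zero] at hgm; omega
    have hg0' : (0 : ℝ) < g := by exact_mod_cast hg0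
    have hm0' : (0 : ℝ) < m := by exact_mod_cast hm0
    have hτ : (σ 0 d : ℝ) ≤ (σ 0 g : ℝ) * σ 0 m := by
      rw [← hgm]; exact_mod_cast sigma_zero_mul_le g m
    have hτq : (σ 0 d : ℝ) ^ q ≤ ((σ 0 g : ℝ) * σ 0 m) ^ q := pow_le_pow_left₀ (by positivity) hτ q
    have hd' : (d : ℝ) = g * m := by rw [← hgm]; push_cast; ring
    simp only [hG, hφ]
    rw [← hg, ← hm, hd', div_le_iff₀ (by positivity)]
    calc (σ 0 d : ℝ) ^ q * g ≤ ((σ 0 g : ℝ) * σ 0 m) ^ q * g :=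
          mul_le_mul_of_nonneg_right hτq hg0'.le
      _ = (σ 0 g : ℝ) ^ q * ((σ 0 m : ℝ) ^ q / m) * (g * m) := by
          rw [mul_pow]; field_simp
  -- injectivity and range of `φ`
  have hinj : Set.InjOn φ (Icc 1 Z : Finset ℕ) := by
    intro a _ b _ hab
    simp only [hφ, Prod.mk.injEq] at hab
    calc a = Nat.gcd a k * (a / Nat.gcd a k) := (hdecomp a).symm
      _ = Nat.gcd b k * (b / Nat.gcd b k) := by rw [hab.2, hab.1]
      _ = b := hdecomp b
  have hrange : (Icc 1 Z).image φ ⊆ k.divisors ×ˢ Icc 1 Z := by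
    intro y hy
    rw [mem_image] at hy
    obtain ⟨d, hd, rfl⟩ := hy
    rw [mem_Icc] at hd
    rw [mem_product, Nat.mem_divisors, mem_Icc]
    have hg0 : 0 < Nat.gcd d k := Nat.gcd_pos_of_pos_left k hd.1
    refine ⟨⟨Nat.gcd_dvd_right d k, hk⟩, ?_, (Nat.div_le_self _ _).trans hd.2⟩
    exact Nat.div_pos (Nat.le_of_dvd hd.1 (Nat.gcd_dvd_left d k)) hg0
  -- the sum over `g ∣ k`
  have h1 : ∑ g ∈ k.divisors, (σ 0 g : ℝ) ^ q ≤ (σ 0 k : ℝ) ^ (q + 1) := by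
    calc ∑ g ∈ k.divisors, (σ 0 g : ℝ) ^ q ≤ ∑ _g ∈ k.divisors, (σ 0 k : ℝ) ^ q := by
          refine sum_le_sum fun g hg => ?_
          have hle : (σ 0 g : ℝ) ≤ σ 0 k := by
            exact_mod_cast sigma_zero_le_of_dvd hk (Nat.dvd_of_mem_divisors hg)
          exact pow_le_pow_left₀ (by positivity) hle q
      _ = (σ 0 k : ℝ) ^ (q + 1) := by
          simp only [sum_const, nsmul_eq_mul, ArithmeticFunction.sigma_zero_apply]
          ring
  calc ∑ d ∈ Icc 1 Z, (σ 0 d : ℝ) ^ q * (Nat.gcd d k : ℝ) / d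
      ≤ ∑ d ∈ Icc 1 Z, G (φ d) := sum_le_sum hterm
    _ = ∑ y ∈ (Icc 1 Z).image φ, G y := (sum_image hinj).symm
    _ ≤ ∑ y ∈ k.divisors ×ˢ Icc 1 Z, G y :=
        sum_le_sum_of_subset_of_nonneg hrange fun y _ _ => hG0 y
    _ = (∑ g ∈ k.divisors, (σ 0 g : ℝ) ^ q) * ∑ m ∈ Icc 1 Z, (σ 0 m : ℝ) ^ q / m := by
        rw [sum_product, sum_mul_sum]
    _ ≤ (σ 0 k : ℝ) ^ (q + 1) * ∑ m ∈ Icc 1 Z, (σ 0 m : ℝ) ^ q / m :=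
        mul_le_mul_of_nonneg_right h1 (sum_nonneg fun m _ => by positivity)

/-! ### `τ^s` in arithmetic progressions to large moduli -/

/-- **An elementary Brun–Titchmarsh-type bound for `τ^s` in residue classes.**  For `s ∈ ℕ` and
`ε > 0` there are `B₁, B₂ ∈ ℕ` and `C > 0` such that for all `X ≥ 2`, `k ≥ 1` with `k X^ε ≤ X` and
every residue class `r (mod k)` (coprime to `k` or not),
`∑_{n ≤ X, n ≡ r (k)} τ(n)^s ≤ C (X/k) τ(k)^{B₁} (log X)^{B₂}`.
(A weak substitute for Shiu's theorem, by Landreau's inequality; see the module docstring.)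
[folklore] -/
theorem sum_AP_sigma_pow_le (s : ℕ) {ε : ℝ} (hε : 0 < ε) :
    ∃ B₁ B₂ : ℕ, ∃ C : ℝ, 0 < C ∧ ∀ X k : ℕ, 2 ≤ X → 0 < k → (k : ℝ) * (X : ℝ) ^ ε ≤ X →
      ∀ r : ZMod k, ∑ n ∈ (Icc 1 X).filter (fun n : ℕ => (n : ZMod k) = r), (σ 0 n : ℝ) ^ s ≤
        C * ((X : ℝ) / k) * (σ 0 k : ℝ) ^ B₁ * Real.log X ^ B₂ := by
  obtain ⟨C₁, hC₁, M, hL⟩ := exists_dvd_card_divisors_le hε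
  obtain ⟨C₂, hC₂, hU⟩ := exists_sum_sigma_zero_pow_div_le (M * s)
  refine ⟨M * s + 1, 2 ^ (M * s + 1), 2 * C₁ ^ s * C₂, by positivity,
    fun X k hX hk hkX r => ?_⟩
  set Z : ℕ := ⌊(X : ℝ) ^ ε⌋₊ with hZ
  set AP := (Icc 1 X).filter (fun n : ℕ => (n : ZMod k) = r) with hAP
  have hk0 : (0 : ℝ) < k := by exact_mod_cast hk
  have hXε0 : (0 : ℝ) ≤ (X : ℝ) ^ ε := by positivity
  -- Step 1: Landreau pointwise, `τ(n)^s ≤ C₁^s ∑_{d ∣ n, d ≤ Z} τ(d)^{Ms}`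
  have hpt : ∀ n ∈ AP, (σ 0 n : ℝ) ^ s ≤
      C₁ ^ s * ∑ d ∈ (Icc 1 Z).filter (· ∣ n), (σ 0 d : ℝ) ^ (M * s) := by
    intro n hn
    have hn' := Finset.mem_Icc.1 (Finset.mem_filter.1 hn).1
    have hn0 : n ≠ 0 := by omega
    have hnX : (n : ℝ) ^ ε ≤ (X : ℝ) ^ ε :=
      Real.rpow_le_rpow (Nat.cast_nonneg n) (by exact_mod_cast hn'.2) hε.le
    obtain ⟨d, hdn, hdy, hτ⟩ := hL n hn0 _ hnX
    have hd0 : 0 < d := Nat.pos_of_dvd_of_pos hdn (by omega)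
    have hdZ : d ∈ (Icc 1 Z).filter (· ∣ n) := by
      rw [Finset.mem_filter, Finset.mem_Icc]
      exact ⟨⟨hd0, Nat.le_floor hdy⟩, hdn⟩
    have h1 : (σ 0 n : ℝ) ^ s ≤ (C₁ * (σ 0 d : ℝ) ^ M) ^ s := by
      refine pow_le_pow_left₀ (by positivity) ?_ s
      simpa only [ArithmeticFunction.sigma_zero_apply] using hτ
    have h2 : ((σ 0 d : ℝ) ^ M) ^ s ≤ ∑ d ∈ (Icc 1 Z).filter (· ∣ n), (σ 0 d : ℝ) ^ (M * s) := by
      rw [← pow_mul]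
      exact Finset.single_le_sum (f := fun d => (σ 0 d : ℝ) ^ (M * s))
        (fun i _ => by positivity) hdZ
    calc (σ 0 n : ℝ) ^ s ≤ (C₁ * (σ 0 d : ℝ) ^ M) ^ s := h1
      _ = C₁ ^ s * ((σ 0 d : ℝ) ^ M) ^ s := mul_pow _ _ _
      _ ≤ _ := mul_le_mul_of_nonneg_left h2 (by positivity)
  -- Step 2: exchange the order of summation
  have hex : ∑ n ∈ AP, ∑ d ∈ (Icc 1 Z).filter (· ∣ n), (σ 0 d : ℝ) ^ (M * s) =
      ∑ d ∈ Icc 1 Z, (σ 0 d : ℝ) ^ (M * s) * ((AP.filter (fun n => d ∣ n)).card : ℝ) := by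
    simp_rw [Finset.sum_filter]
    rw [Finset.sum_comm]
    refine Finset.sum_congr rfl fun d _ => ?_
    rw [← Finset.sum_filter, Finset.sum_const, nsmul_eq_mul, mul_comm]
  -- Step 3: count the multiples of `d` in the class
  have hcount : ∀ d ∈ Icc 1 Z, ((AP.filter (fun n => d ∣ n)).card : ℝ) ≤
      2 * ((X : ℝ) / k) * ((Nat.gcd d k : ℝ) / d) := by
    intro d hd
    rw [Finset.mem_Icc] at hd
    have hd0 : 0 < d := hd.1
    have hdr : (0 : ℝ) < d := by exact_mod_cast hd0
    have hfilt : AP.filter (fun n => d ∣ n) =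
        (Icc 1 X).filter (fun n : ℕ => (n : ZMod k) = r ∧ d ∣ n) := by
      ext n
      simp only [hAP, Finset.mem_filter, and_assoc]
    have hc : (AP.filter (fun n => d ∣ n)).card ≤ X / Nat.lcm d k + 1 := by
      rw [hfilt]
      exact card_filter_dvd_le X hd0 hk r
    set L := Nat.lcm d k with hLdef
    have hL0 : 0 < L := Nat.lcm_pos hd0 hk
    have hLr : (0 : ℝ) < L := by exact_mod_cast hL0
    have hg0 : 0 < Nat.gcd d k := Nat.gcd_pos_of_pos_left k hd0
    have hgr : (0 : ℝ) < Nat.gcd d k := by exact_mod_cast hg0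
    have hgl : (Nat.gcd d k : ℝ) * L = d * k := by exact_mod_cast Nat.gcd_mul_lcm d k
    have hLdk : L ≤ d * k := by
      calc L ≤ Nat.gcd d k * L := Nat.le_mul_of_pos_left L hg0
        _ = d * k := Nat.gcd_mul_lcm d k
    have hLX : (L : ℝ) ≤ X := by
      calc (L : ℝ) ≤ ((d * k : ℕ) : ℝ) := by exact_mod_cast hLdk
        _ = (d : ℝ) * k := by push_cast; ring
        _ ≤ (Z : ℝ) * k := by gcongr; exact_mod_cast hd.2
        _ ≤ (X : ℝ) ^ ε * k := by gcongr; exact Nat.floor_le hXε0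
        _ = (k : ℝ) * (X : ℝ) ^ ε := mul_comm _ _
        _ ≤ X := hkX
    have hXL : (1 : ℝ) ≤ (X : ℝ) / L := by rw [le_div_iff₀ hLr, one_mul]; exact hLX
    have hL' : (L : ℝ) = d * k / Nat.gcd d k := by
      rw [eq_div_iff hgr.ne', mul_comm]; exact hgl
    calc ((AP.filter (fun n => d ∣ n)).card : ℝ) ≤ ((X / L + 1 : ℕ) : ℝ) := by exact_mod_cast hc
      _ ≤ (X : ℝ) / L + 1 := by
          push_cast
          have h := (Nat.cast_div_le : ((X / L : ℕ) : ℝ) ≤ (X : ℝ) / L)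
          linarith
      _ ≤ (X : ℝ) / L + (X : ℝ) / L := by linarith
      _ = 2 * ((X : ℝ) / k) * ((Nat.gcd d k : ℝ) / d) := by
          rw [hL']
          field_simp
          ring
  -- Step 4: assemble
  have hmain : ∑ n ∈ AP, (σ 0 n : ℝ) ^ s ≤ C₁ ^ s * (2 * ((X : ℝ) / k) *
      ∑ d ∈ Icc 1 Z, (σ 0 d : ℝ) ^ (M * s) * (Nat.gcd d k : ℝ) / d) := by
    calc ∑ n ∈ AP, (σ 0 n : ℝ) ^ s
        ≤ ∑ n ∈ AP, C₁ ^ s * ∑ d ∈ (Icc 1 Z).filter (· ∣ n), (σ 0 d : ℝ) ^ (M * s) :=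
          Finset.sum_le_sum hpt
      _ = C₁ ^ s * ∑ d ∈ Icc 1 Z, (σ 0 d : ℝ) ^ (M * s) * ((AP.filter (fun n => d ∣ n)).card : ℝ) := by
          rw [← Finset.mul_sum, hex]
      _ ≤ C₁ ^ s * ∑ d ∈ Icc 1 Z,
            (σ 0 d : ℝ) ^ (M * s) * (2 * ((X : ℝ) / k) * ((Nat.gcd d k : ℝ) / d)) := by
          gcongr with d hd
          exact hcount d hd
      _ = C₁ ^ s * (2 * ((X : ℝ) / k) *
            ∑ d ∈ Icc 1 Z, (σ 0 d : ℝ) ^ (M * s) * (Nat.gcd d k : ℝ) / d) := by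
          congr 1
          rw [Finset.mul_sum]
          refine Finset.sum_congr rfl fun d _ => ?_
          ring
  -- Step 5: the `d`-sum, `≤ τ(k)^{Ms+1} C₂ (log X)^{2^{Ms+1}}`
  have hT := sum_sigma_pow_mul_gcd_div_le (Nat.pos_iff_ne_zero.1 hk) (M * s) Z
  have hUZ : ∑ m ∈ Icc 1 Z, (σ 0 m : ℝ) ^ (M * s) / m ≤ C₂ * Real.log X ^ (2 ^ (M * s + 1)) := by
    set Z' := max Z 2 with hZ'
    have h2Z' : 2 ≤ Z' := le_max_right _ _
    have hZ'0 : (0 : ℝ) < Z' := by exact_mod_cast (by omega : 0 < Z')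
    have hsub : Icc 1 Z ⊆ Icc 1 Z' := Finset.Icc_subset_Icc_right (le_max_left _ _)
    have hZ'X : (Z' : ℝ) ≤ X := by
      rcases le_total Z 2 with h | h
      · rw [hZ', max_eq_right h]; exact_mod_cast hX
      · rw [hZ', max_eq_left h]
        calc (Z : ℝ) ≤ (X : ℝ) ^ ε := Nat.floor_le hXε0
          _ ≤ (k : ℝ) * (X : ℝ) ^ ε := le_mul_of_one_le_left hXε0 (by exact_mod_cast hk)
          _ ≤ X := hkX
    have hlog : Real.log Z' ≤ Real.log X := Real.log_le_log hZ'0 hZ'X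
    have hlog0 : 0 ≤ Real.log Z' := Real.log_nonneg (by exact_mod_cast (by omega : 1 ≤ Z'))
    calc ∑ m ∈ Icc 1 Z, (σ 0 m : ℝ) ^ (M * s) / m ≤ ∑ m ∈ Icc 1 Z', (σ 0 m : ℝ) ^ (M * s) / m :=
          Finset.sum_le_sum_of_subset_of_nonneg hsub fun m _ _ => by positivity
      _ ≤ C₂ * Real.log Z' ^ (2 ^ (M * s + 1)) := hU Z' h2Z'
      _ ≤ C₂ * Real.log X ^ (2 ^ (M * s + 1)) := by gcongr
  calc ∑ n ∈ AP, (σ 0 n : ℝ) ^ s ≤ C₁ ^ s * (2 * ((X : ℝ) / k) *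
        ∑ d ∈ Icc 1 Z, (σ 0 d : ℝ) ^ (M * s) * (Nat.gcd d k : ℝ) / d) := hmain
    _ ≤ C₁ ^ s * (2 * ((X : ℝ) / k) *
        ((σ 0 k : ℝ) ^ (M * s + 1) * (C₂ * Real.log X ^ (2 ^ (M * s + 1))))) := by
        gcongr
        exact hT.trans (mul_le_mul_of_nonneg_left hUZ (by positivity))
    _ = 2 * C₁ ^ s * C₂ * ((X : ℝ) / k) * (σ 0 k : ℝ) ^ (M * s + 1) *
        Real.log X ^ (2 ^ (M * s + 1)) := by ring

/-- `u^A v^A ≤ u^s + v^s` for `u, v ≥ 1` and `2A ≤ s` (`uv ≤ u² + v²`, `u^{2A} ≤ u^s`). [folklore] -/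
theorem rpow_mul_rpow_le {u v A : ℝ} {s : ℕ} (hu : 1 ≤ u) (hv : 1 ≤ v) (hs : 2 * A ≤ s) :
    u ^ A * v ^ A ≤ u ^ s + v ^ s := by
  have h1 : ∀ w : ℝ, 1 ≤ w → (w ^ A) ^ 2 ≤ w ^ s := by
    intro w hw
    have hw0 : 0 ≤ w := by linarith
    calc (w ^ A) ^ 2 = w ^ (A * 2) := by rw [Real.rpow_mul hw0, Real.rpow_two]
      _ ≤ w ^ (s : ℝ) := Real.rpow_le_rpow_of_exponent_le hw (by linarith)
      _ = w ^ s := Real.rpow_natCast w s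
  have hp : 0 ≤ u ^ A := Real.rpow_nonneg (by linarith) A
  have hq : 0 ≤ v ^ A := Real.rpow_nonneg (by linarith) A
  have h3 : u ^ A * v ^ A ≤ (u ^ A) ^ 2 + (v ^ A) ^ 2 := by
    nlinarith [sq_nonneg (u ^ A - v ^ A), mul_nonneg hp hq]
  linarith [h1 u hu, h1 v hv]

end BFILemma3

open BFILemma3 in
/-- **Discharge of `BombieriFriedlanderIwaniecLemma3`** (Bombieri–Friedlander–Iwaniec 1986, §2
Lemma 3, p. 211: for `a ≠ 0`, `A > 0`, `ε > 0` there are `B, C, x₀` with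
`∑_{|a| < m ≤ x, m ≡ l (k)} τ(m)^A τ(m − a)^A ≤ C (x/k) (τ(k) log x)^B` for `x ≥ x₀`,
`1 ≤ k ≤ x^{1−ε}`, all `l (mod k)`).  PROVED (see the module docstring): `uv ≤ u² + v²` in place of
Cauchy's inequality, `τ^{2A} ≤ τ^s` (`s = ⌈2A⌉`), the shift `n = m − a` (class `l − a`, range
`≤ x + |a|`), and the elementary bound `BFILemma3.sum_AP_sigma_pow_le` (with `ε' = min ε 1` halved)
in place of Shiu's Theorem 2; thresholds from `x^{ε'/2} → ∞`.
[cite: BombieriFriedlanderIwaniecActa1986, §2 Lemma 3 p. 211] -/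
theorem BombieriFriedlanderIwaniecLemma3_holds : BombieriFriedlanderIwaniecLemma3 := by
  intro a ha A hA ε hε
  -- `ε' = min ε 1`, `s = ⌈2A⌉`
  set ε' : ℝ := min ε 1 with hε'
  have hε'0 : 0 < ε' := lt_min hε one_pos
  have hε'1 : ε' ≤ 1 := min_le_right _ _
  have hε'ε : ε' ≤ ε := min_le_left _ _
  obtain ⟨s, hs⟩ : ∃ s : ℕ, 2 * A ≤ s := ⟨⌈2 * A⌉₊, Nat.le_ceil _⟩
  obtain ⟨B₁, B₂, C, hC, hCL⟩ := sum_AP_sigma_pow_le s (half_pos hε'0)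
  set B : ℕ := max B₁ B₂ with hB
  set t : ℕ := a.natAbs with ht
  -- thresholds: `x ≥ 3`, `x^{ε'/2} ≥ 4`, `x ≥ |a|`
  have hev : ∀ᶠ x : ℝ in Filter.atTop, 3 ≤ x ∧ ((4 : ℝ) ≤ x ^ (ε' / 2) ∧ (t : ℝ) ≤ x) :=
    (Filter.eventually_ge_atTop 3).and
      (((tendsto_rpow_atTop (half_pos hε'0)).eventually_ge_atTop 4).and
        (Filter.eventually_ge_atTop (t : ℝ)))
  obtain ⟨x₀, hx₀⟩ := Filter.eventually_atTop.1 hev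
  refine ⟨(B : ℝ), C * (1 + 2 ^ (B₂ + 1)), x₀, fun x hx k hk hkx l => ?_⟩
  obtain ⟨hx3, hx4, hxt⟩ := hx₀ x hx
  rw [Real.rpow_natCast]
  have hx0 : 0 < x := by linarith
  have hx1 : 1 ≤ x := by linarith
  have hlogx : 1 ≤ Real.log x := by
    have he : Real.exp 1 ≤ x := by have := Real.exp_one_lt_d9; linarith
    calc (1 : ℝ) = Real.log (Real.exp 1) := (Real.log_exp 1).symm
      _ ≤ Real.log x := Real.log_le_log (Real.exp_pos 1) he
  set X : ℕ := ⌊x⌋₊ with hX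
  have hX2 : 2 ≤ X := Nat.le_floor (by exact_mod_cast (show (2 : ℝ) ≤ x by linarith))
  have hXx : (X : ℝ) ≤ x := Nat.floor_le hx0.le
  have hxX : x < X + 1 := Nat.lt_floor_add_one x
  have hX'2 : 2 ≤ X + t := hX2.trans (Nat.le_add_right X t)
  have hX'x : ((X + t : ℕ) : ℝ) ≤ 2 * x := by push_cast; linarith
  have hX'X : (X : ℝ) ≤ ((X + t : ℕ) : ℝ) := by exact_mod_cast Nat.le_add_right X t
  have hk0 : (0 : ℝ) < k := by exact_mod_cast hk
  have hτk : (1 : ℝ) ≤ σ 0 k := by exact_mod_cast one_le_sigma_zero (by omega : k ≠ 0)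
  -- `k x^{ε'/2} ≤ x/4`
  have hkx' : (k : ℝ) ≤ x ^ (1 - ε') :=
    hkx.trans (Real.rpow_le_rpow_of_exponent_le hx1 (by linarith))
  have hsplit : x ^ (1 - ε') * x ^ (ε' / 2) * x ^ (ε' / 2) = x := by
    rw [← Real.rpow_add hx0, ← Real.rpow_add hx0]
    have : 1 - ε' + ε' / 2 + ε' / 2 = 1 := by ring
    rw [this, Real.rpow_one]
  have hkey : (k : ℝ) * x ^ (ε' / 2) ≤ x / 4 := by
    have h1 : (k : ℝ) * x ^ (ε' / 2) ≤ x ^ (1 - ε') * x ^ (ε' / 2) :=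
      mul_le_mul_of_nonneg_right hkx' (by positivity)
    have h2 : x ^ (1 - ε') * x ^ (ε' / 2) * 4 ≤ x ^ (1 - ε') * x ^ (ε' / 2) * x ^ (ε' / 2) :=
      mul_le_mul_of_nonneg_left hx4 (by positivity)
    rw [hsplit] at h2
    linarith
  -- the hypotheses `k X^{ε'/2} ≤ X` of the AP bound, for `X` and `X + |a|`
  have hXpow : (X : ℝ) ^ (ε' / 2) ≤ x ^ (ε' / 2) :=
    Real.rpow_le_rpow (Nat.cast_nonneg X) hXx (by positivity)
  have hkX1 : (k : ℝ) * (X : ℝ) ^ (ε' / 2) ≤ X := by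
    calc (k : ℝ) * (X : ℝ) ^ (ε' / 2) ≤ (k : ℝ) * x ^ (ε' / 2) :=
          mul_le_mul_of_nonneg_left hXpow hk0.le
      _ ≤ x / 4 := hkey
      _ ≤ x - 1 := by linarith
      _ ≤ X := by linarith
  have h2pow : (2 * x) ^ (ε' / 2) ≤ 2 * x ^ (ε' / 2) := by
    rw [Real.mul_rpow zero_le_two hx0.le]
    refine mul_le_mul_of_nonneg_right ?_ (by positivity)
    calc (2 : ℝ) ^ (ε' / 2) ≤ 2 ^ (1 : ℝ) :=
          Real.rpow_le_rpow_of_exponent_le one_le_two (by linarith)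
      _ = 2 := Real.rpow_one 2
  have hX'pow : ((X + t : ℕ) : ℝ) ^ (ε' / 2) ≤ 2 * x ^ (ε' / 2) :=
    (Real.rpow_le_rpow (Nat.cast_nonneg _) hX'x (by positivity)).trans h2pow
  have hkX2 : (k : ℝ) * ((X + t : ℕ) : ℝ) ^ (ε' / 2) ≤ ((X + t : ℕ) : ℝ) := by
    calc (k : ℝ) * ((X + t : ℕ) : ℝ) ^ (ε' / 2) ≤ (k : ℝ) * (2 * x ^ (ε' / 2)) :=
          mul_le_mul_of_nonneg_left hX'pow hk0.le
      _ = 2 * ((k : ℝ) * x ^ (ε' / 2)) := by ring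
      _ ≤ 2 * (x / 4) := by linarith
      _ ≤ x - 1 := by linarith
      _ ≤ X := by linarith
      _ ≤ ((X + t : ℕ) : ℝ) := hX'X
  have hS1 := hCL X k hX2 hk hkX1 l
  have hS2 := hCL (X + t) k hX'2 hk hkX2 (l - (a : ZMod k))
  -- the right-hand sides in the common shape `(x/k) (τ(k) log x)^B`
  have hτB : (σ 0 k : ℝ) ^ B₁ ≤ (σ 0 k : ℝ) ^ B := pow_le_pow_right₀ hτk (le_max_left _ _)
  have hR1 : C * ((X : ℝ) / k) * (σ 0 k : ℝ) ^ B₁ * Real.log X ^ B₂ ≤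
      C * (x / k) * ((σ 0 k : ℝ) * Real.log x) ^ B := by
    have hX0 : (0 : ℝ) < X := by exact_mod_cast (by omega : 0 < X)
    have hlogX : Real.log X ≤ Real.log x := Real.log_le_log hX0 hXx
    have hlogX0 : 0 ≤ Real.log X := Real.log_nonneg (by exact_mod_cast (by omega : 1 ≤ X))
    have hpow : Real.log X ^ B₂ ≤ Real.log x ^ B :=
      (pow_le_pow_left₀ hlogX0 hlogX B₂).trans (pow_le_pow_right₀ hlogx (le_max_right _ _))
    have hdiv : (X : ℝ) / k ≤ x / k := div_le_div_of_nonneg_right hXx hk0.le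
    calc C * ((X : ℝ) / k) * (σ 0 k : ℝ) ^ B₁ * Real.log X ^ B₂
        ≤ C * (x / k) * (σ 0 k : ℝ) ^ B * Real.log x ^ B :=
          mul_le_mul (mul_le_mul (mul_le_mul_of_nonneg_left hdiv hC.le) hτB (by positivity)
            (by positivity)) hpow (by positivity) (by positivity)
      _ = C * (x / k) * ((σ 0 k : ℝ) * Real.log x) ^ B := by rw [mul_pow]; ring
  have hR2 : C * (((X + t : ℕ) : ℝ) / k) * (σ 0 k : ℝ) ^ B₁ * Real.log ((X + t : ℕ) : ℝ) ^ B₂ ≤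
      C * 2 ^ (B₂ + 1) * (x / k) * ((σ 0 k : ℝ) * Real.log x) ^ B := by
    have hX'0 : (0 : ℝ) < ((X + t : ℕ) : ℝ) := by exact_mod_cast (by omega : 0 < X + t)
    have hlogX' : Real.log ((X + t : ℕ) : ℝ) ≤ 2 * Real.log x := by
      calc Real.log ((X + t : ℕ) : ℝ) ≤ Real.log (2 * x) := Real.log_le_log hX'0 hX'x
        _ = Real.log 2 + Real.log x := Real.log_mul two_ne_zero hx0.ne'
        _ ≤ Real.log x + Real.log x := by
            have : Real.log 2 ≤ Real.log x := Real.log_le_log two_pos (by linarith)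
            linarith
        _ = 2 * Real.log x := by ring
    have hlogX'0 : 0 ≤ Real.log ((X + t : ℕ) : ℝ) :=
      Real.log_nonneg (by exact_mod_cast (by omega : 1 ≤ X + t))
    have hpow : Real.log ((X + t : ℕ) : ℝ) ^ B₂ ≤ 2 ^ B₂ * Real.log x ^ B := by
      calc Real.log ((X + t : ℕ) : ℝ) ^ B₂ ≤ (2 * Real.log x) ^ B₂ :=
            pow_le_pow_left₀ hlogX'0 hlogX' B₂
        _ = 2 ^ B₂ * Real.log x ^ B₂ := mul_pow _ _ _
        _ ≤ 2 ^ B₂ * Real.log x ^ B :=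
            mul_le_mul_of_nonneg_left (pow_le_pow_right₀ hlogx (le_max_right _ _))
              (by positivity)
    have hdiv : ((X + t : ℕ) : ℝ) / k ≤ 2 * (x / k) := by
      rw [mul_div_assoc']
      exact div_le_div_of_nonneg_right hX'x hk0.le
    calc C * (((X + t : ℕ) : ℝ) / k) * (σ 0 k : ℝ) ^ B₁ * Real.log ((X + t : ℕ) : ℝ) ^ B₂
        ≤ C * (2 * (x / k)) * (σ 0 k : ℝ) ^ B * (2 ^ B₂ * Real.log x ^ B) :=
          mul_le_mul (mul_le_mul (mul_le_mul_of_nonneg_left hdiv hC.le) hτB (by positivity)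
            (by positivity)) hpow (by positivity) (by positivity)
      _ = C * 2 ^ (B₂ + 1) * (x / k) * ((σ 0 k : ℝ) * Real.log x) ^ B := by
          rw [mul_pow]; ring
  -- the summand: `τ(m)^A τ(m-a)^A ≤ τ(m)^s + τ(m-a)^s`
  set F := (Icc 1 X).filter (fun m : ℕ => |a| < (m : ℤ) ∧ (m : ZMod k) = l) with hF
  have hterm : ∀ m ∈ F, (σ 0 m : ℝ) ^ A * (σ 0 ((m : ℤ) - a).toNat : ℝ) ^ A ≤
      (σ 0 m : ℝ) ^ s + (σ 0 ((m : ℤ) - a).toNat : ℝ) ^ s := by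
    intro m hm
    rw [hF, Finset.mem_filter, Finset.mem_Icc] at hm
    have hn1 := BombieriFriedlanderIwaniecLemma3.one_le_toNat_sub hm.2.1
    refine rpow_mul_rpow_le ?_ ?_ hs
    · exact_mod_cast one_le_sigma_zero (by omega : m ≠ 0)
    · exact_mod_cast one_le_sigma_zero (by omega : ((m : ℤ) - a).toNat ≠ 0)
  -- first sum: drop the condition `|a| < m`
  have hsum1 : ∑ m ∈ F, (σ 0 m : ℝ) ^ s ≤
      ∑ n ∈ (Icc 1 X).filter (fun n : ℕ => (n : ZMod k) = l), (σ 0 n : ℝ) ^ s := by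
    refine Finset.sum_le_sum_of_subset_of_nonneg (fun m hm => ?_) fun _ _ _ => by positivity
    rw [hF, Finset.mem_filter] at hm
    exact Finset.mem_filter.2 ⟨hm.1, hm.2.2⟩
  -- second sum: shift by `a`
  have hsum2 : ∑ m ∈ F, (σ 0 ((m : ℤ) - a).toNat : ℝ) ^ s ≤
      ∑ n ∈ (Icc 1 (X + t)).filter (fun n : ℕ => (n : ZMod k) = l - (a : ZMod k)),
        (σ 0 n : ℝ) ^ s := by
    have hnonneg : ∀ m ∈ F, (0 : ℤ) ≤ (m : ℤ) - a := by
      intro m hm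
      rw [hF, Finset.mem_filter] at hm
      have := (abs_lt.1 hm.2.1).2
      omega
    have hginj : Set.InjOn (fun m : ℕ => ((m : ℤ) - a).toNat) F := by
      intro m hm m' hm' h
      have h1 := hnonneg m (Finset.mem_coe.1 hm)
      have h2 := hnonneg m' (Finset.mem_coe.1 hm')
      have h' : (((m : ℤ) - a).toNat : ℤ) = (((m' : ℤ) - a).toNat : ℤ) := by
        exact_mod_cast h
      rw [Int.toNat_of_nonneg h1, Int.toNat_of_nonneg h2] at h'
      exact_mod_cast (sub_left_inj.1 h')
    have hgim : F.image (fun m : ℕ => ((m : ℤ) - a).toNat) ⊆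
        (Icc 1 (X + t)).filter (fun n : ℕ => (n : ZMod k) = l - (a : ZMod k)) := by
      intro n hn
      rw [Finset.mem_image] at hn
      obtain ⟨m, hm, rfl⟩ := hn
      have h0 := hnonneg m hm
      rw [hF, Finset.mem_filter, Finset.mem_Icc] at hm
      obtain ⟨⟨-, hmX⟩, hma, hml⟩ := hm
      have hgz : ((((m : ℤ) - a).toNat : ℕ) : ℤ) = (m : ℤ) - a := Int.toNat_of_nonneg h0
      rw [Finset.mem_filter, Finset.mem_Icc]
      refine ⟨⟨BombieriFriedlanderIwaniecLemma3.one_le_toNat_sub hma, ?_⟩, ?_⟩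
      · have h1 : ((((m : ℤ) - a).toNat : ℕ) : ℤ) ≤ ((X + t : ℕ) : ℤ) := by
          rw [hgz, Nat.cast_add, ht, Int.natCast_natAbs]
          have hmX' : (m : ℤ) ≤ X := by exact_mod_cast hmX
          have : -a ≤ |a| := neg_le_abs a
          linarith
        exact_mod_cast h1
      · rw [← Int.cast_natCast (R := ZMod k), hgz, Int.cast_sub, Int.cast_natCast, hml]
    calc ∑ m ∈ F, (σ 0 ((m : ℤ) - a).toNat : ℝ) ^ s
        = ∑ n ∈ F.image (fun m : ℕ => ((m : ℤ) - a).toNat), (σ 0 n : ℝ) ^ s := by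
          rw [Finset.sum_image hginj]
      _ ≤ _ := Finset.sum_le_sum_of_subset_of_nonneg hgim fun _ _ _ => by positivity
  -- conclusion
  calc ∑ m ∈ F, (σ 0 m : ℝ) ^ A * (σ 0 ((m : ℤ) - a).toNat : ℝ) ^ A
      ≤ ∑ m ∈ F, ((σ 0 m : ℝ) ^ s + (σ 0 ((m : ℤ) - a).toNat : ℝ) ^ s) :=
        Finset.sum_le_sum hterm
    _ = ∑ m ∈ F, (σ 0 m : ℝ) ^ s + ∑ m ∈ F, (σ 0 ((m : ℤ) - a).toNat : ℝ) ^ s :=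
        Finset.sum_add_distrib
    _ ≤ C * (x / k) * ((σ 0 k : ℝ) * Real.log x) ^ B +
          C * 2 ^ (B₂ + 1) * (x / k) * ((σ 0 k : ℝ) * Real.log x) ^ B :=
        add_le_add (hsum1.trans (hS1.trans hR1)) (hsum2.trans (hS2.trans hR2))
    _ = C * (1 + 2 ^ (B₂ + 1)) * (x / k) * ((σ 0 k : ℝ) * Real.log x) ^ B := by ring

end Literature.NumberTheory.Sieve
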